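import Literature.NumberTheory.EllipticCurves.MordellCurvePhiDescentHom
import HarnessLib

/-!
# The `μ₃`-Kummer torsor classes `[C_a] ∈ H¹(K, W)` attached to a `μ₃`-kernel point `T ∈ W(K̄)`
# (Silverman, *AEC*, X.4.2 (a); Cohen–Pazuki 2009, §1: descent via a `3`-isogeny with kernel `μ₃`)

Topic `NumberTheory/EllipticCurves`. Generalisation of the tree's `MordellCurveThreeDescent`
(`MordellDescent.torsorClass hc hD ha`, for the Mordell curves `y² = x³ − 3c²` and their kernel
point `T = (0, c√−3)`) from `(mordellCurve D, torsT)` to an ARBITRARY Weierstrass curve `W` over a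
field `K` of characteristic `0` equipped with a `μ₃`-KERNEL DATUM: a geometric point
`T ∈ W(K̄)` of order `3` on which `Γ_K` acts through the mod-`3` cyclotomic sign
`ε = MordellDescent.eps` (`σT = T` if `σ√−3 = √−3`, `σT = −T` otherwise), i.e. `⟨T⟩ ≅ μ₃` as a
Galois module (`MuThreeKernel W`). Examples: the Mordell datum (`MuThreeKernel.ofMordell`); the point
`(0, s₁√−3)` of Cohen–Pazuki's curves `y² = x³ − 3(m₁x + s₁)²` (their `D = −3`, [CohenPazuki2009] §1,
«`T = (0, b√D)`»); and, over a field containing `√−3` (where `ε ≡ 1`), ANY `K`-rational point of order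
`3` — so that the `3`-isogeny descent of a curve with a rational `3`-torsion point and `j ≠ 0` (route
ShaPrimaryTransfer's cross-prime carrier `y² − 21xy + 6137y = x³`) runs on both isogenies with one
machine.

For such a datum and `a ∈ K*` the continuous crossed homomorphism
`σ ↦ (kummerExp a σ) · T : Γ_K → W(K̄)` (`kummerExp a` = the additive Kummer cocycle of `∛a`, tree
`MordellDescent.kummerExp`, `σ(∛a) = ω^{kummerExp a σ} ∛a`) is a `1`-cocycle PRECISELY because `T` and
`ω` are multiplied by the same sign `ε(σ)`; its class is
**`MuThreeKernel.torsorClass 𝒯 ha ∈ H¹(K, W)`** — the image of `a` under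
`K*/K*³ = H¹(K, μ₃) = H¹(K, ⟨T⟩) → H¹(K, W)` (Silverman X.4.2 (a): `H¹(G, E[φ]) → WC(E/K)[φ]`).

* `MuThreeKernel W` (structure: `T`, `T ≠ 0`, `T + T = −T`, `σ • T = ±T` by the sign of `σ` on `√−3`);
  `MuThreeKernel.ofMordell hc hD` recovers the tree's datum.
* `𝒯.chiT : ℤ/3ℤ →+ W(K̄)`, `n ↦ nT` (injective, `σ(nT) = (ε(σ)n)T`).
* `𝒯.torsorCocycle ha`, `𝒯.torsorClass ha`; `3 · [C_a] = 0`; `[C_{b³}] = 0`; `[C_{ab}] = [C_a] + [C_b]`;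
  the homomorphisms `𝒯.torsorClassHom : Kˣ →* H¹(K, W)` and `𝒯.torsorClassQuotHom : Kˣ/Kˣ³ →* H¹(K, W)`.

The proofs are those of `MordellCurveThreeDescent` verbatim (only `T + T = −T` and the sign rule are
used). What is NOT here: the image theorem (`ker f_* = im [C_·]`, sequel `MuThreeTorsorImage`), the
kernel theorem and the local conditions (they need an explicit isogeny).

## References

* [SilvermanAEC2009] J. H. Silverman, *The Arithmetic of Elliptic Curves*, 2nd ed., GTM 106 (2009),
  VIII.§2 (Kummer pairing), X.§3 (`WC(E/K) ≅ H¹(K, E)`), Thm. X.4.2 (a), Prop. X.4.9.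
* [CohenPazuki2009] H. Cohen, F. Pazuki, *Elementary 3-descent with a 3-isogeny*, Acta Arith. 140
  (2009) 369–404, §1 (the curves `y² = x³ + D(ax+b)²`, `T = (0, b√D)`, Definition 1.3, Prop. 1.4).
* [Cassels1964ArithmeticVI] J. W. S. Cassels, J. reine angew. Math. 214/215 (1964) 65–70, p. 65.
* Template in the tree: `Literature.NumberTheory.EllipticCurves.MordellCurveThreeDescent`.

## Design

`noncomputable section`, `open scoped Classical`, one universe `u` with `K : Type u` (rules of the
`Sha`/`GaloisAction` group). The datum is a structure (data `T` + the three properties the cocycle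
identity consumes), in the spirit of CONVENTIONS §9; everything else is a definition or theorem in its
namespace, used through dot notation `𝒯.torsorClass`.
-/

noncomputable section

open scoped Classical

open WeierstrassCurve

universe u

namespace Literature.NumberTheory.EllipticCurves

open MordellDescent

variable {K : Type u} [Field K]

/-! ## `μ₃`-kernel data -/

/-- **A `μ₃`-kernel datum on a Weierstrass curve `W/K`**: a geometric point `T ∈ W(K̄)` of order `3`
(`T ≠ O`, `T + T = −T`) such that `σT = T` when `σ√−3 = √−3` and `σT = −T` otherwise — i.e. the
subgroup `{O, ±T}` is `Γ_K`-stable and isomorphic to `μ₃` as a Galois module (the kernel of a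
`3`-isogeny whose dual has `K`-rational kernel; Cohen–Pazuki's `T = (0, b√D)` with `D = −3`, or any
rational point of order `3` when `√−3 ∈ K`). [cite: CohenPazuki2009, §1.2 (T = (0, b√D)) and Proposition 1.4 (1)] -/
structure MuThreeKernel (W : WeierstrassCurve K) where
  /-- The kernel point `T ∈ W(K̄)`. -/
  T : geomPoints W
  /-- `T ≠ O`. -/
  T_ne_zero : T ≠ 0
  /-- `T + T = −T`: `T` has order `3`. -/
  T_add_T : T + T = -T
  /-- `Γ_K` acts on `T` through the mod-`3` cyclotomic sign. -/
  smul_T : ∀ σ : Field.absoluteGaloisGroup K,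
    σ • T = if galAut σ (theta K) = theta K then T else -T

namespace MuThreeKernel

variable {W : WeierstrassCurve K} (𝒯 : MuThreeKernel W)

/-- The tree's Mordell datum: `T = (0, c√−3)` on `y² = x³ − 3c²` (`MordellDescent.torsT`).
[cite: Cassels1964ArithmeticVI, p. 65] -/
def ofMordell [CharZero K] {D c : K} (hc : c ≠ 0) (hD : D = -3 * c ^ 2) : MuThreeKernel (mordellCurve D) where
  T := torsT hc hD
  T_ne_zero := torsT_ne_zero hc hD
  T_add_T := torsT_add_torsT hc hD
  smul_T := smul_torsT hc hD

/-- `ofMordell` has kernel point `torsT`. [cite: SilvermanAEC2009, Thm. X.4.2 (a)] -/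
@[simp] theorem ofMordell_T [CharZero K] {D c : K} (hc : c ≠ 0) (hD : D = -3 * c ^ 2) :
    (ofMordell hc hD).T = torsT hc hD := rfl

/-- `3T = O`. [cite: SilvermanAEC2009, Thm. X.4.2 (a)] -/
theorem three_nsmul_T : (3 : ℕ) • 𝒯.T = 0 := by
  rw [succ_nsmul, two_nsmul, 𝒯.T_add_T, neg_add_cancel]

/-- `T ≠ −T` (else `T + T = T`, `T = O`). [cite: SilvermanAEC2009, Thm. X.4.2 (a)] -/
theorem T_ne_neg : 𝒯.T ≠ -𝒯.T := fun h => by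
  have h2 : 𝒯.T + 𝒯.T = 𝒯.T := by rw [𝒯.T_add_T]; exact h.symm
  exact 𝒯.T_ne_zero (by simpa using h2)

/-- `σ • T = ε(σ) • T` with the sign as a natural exponent (`MordellDescent.epsNat`). [cite: SilvermanAEC2009, Thm. X.4.2 (a)] -/
theorem smul_T_eq_epsNat_nsmul (σ : Field.absoluteGaloisGroup K) : σ • 𝒯.T = epsNat σ • 𝒯.T := by
  rw [𝒯.smul_T σ, epsNat]
  split_ifs
  · rw [one_nsmul]
  · rw [two_nsmul, 𝒯.T_add_T]

/-! ## `n ↦ nT` -/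

/-- The additive map `ℤ/3ℤ → W(K̄)`, `n ↦ n T` (well defined as `3T = O`). [cite: SilvermanAEC2009, Thm. X.4.2 (a)] -/
def chiT : ZMod 3 →+ geomPoints W :=
  ZMod.lift 3 ⟨zmultiplesHom (geomPoints W) 𝒯.T, by
    change ((3 : ℕ) : ℤ) • 𝒯.T = 0
    rw [natCast_zsmul, three_nsmul_T]⟩

/-- `chiT z = z T` for `z ∈ ℤ`. [cite: SilvermanAEC2009, Thm. X.4.2 (a)] -/
theorem chiT_intCast (z : ℤ) : 𝒯.chiT (z : ZMod 3) = z • 𝒯.T :=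
  ZMod.lift_coe 3 _ z

/-- `chiT 1 = T`. [cite: SilvermanAEC2009, Thm. X.4.2 (a)] -/
theorem chiT_one : 𝒯.chiT 1 = 𝒯.T := by
  rw [← Int.cast_one, chiT_intCast, one_zsmul]

/-- `chiT k = k T` for `k ∈ ℕ`. [cite: SilvermanAEC2009, Thm. X.4.2 (a)] -/
theorem chiT_natCast (k : ℕ) : 𝒯.chiT (k : ZMod 3) = k • 𝒯.T := by
  rw [← Int.cast_natCast, chiT_intCast, natCast_zsmul]

/-- `chiT n = n.val • T`. [cite: SilvermanAEC2009, Thm. X.4.2 (a)] -/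
theorem chiT_eq_val_nsmul (n : ZMod 3) : 𝒯.chiT n = n.val • 𝒯.T := by
  conv_lhs => rw [← ZMod.natCast_zmod_val n]
  exact 𝒯.chiT_natCast n.val

/-- `n ↦ nT` is injective on `ℤ/3ℤ` (`T` has order `3`). [cite: SilvermanAEC2009, Thm. X.4.2 (a)] -/
theorem chiT_injective : Function.Injective 𝒯.chiT := by
  have hT := 𝒯.T_ne_zero
  refine (injective_iff_map_eq_zero _).mpr fun n hn => ?_
  rw [chiT_eq_val_nsmul] at hn
  have hlt := n.val_lt
  have h3 : n.val = 0 ∨ n.val = 1 ∨ n.val = 2 := by omega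
  rcases h3 with h0 | h1 | h2
  · exact (ZMod.val_eq_zero n).mp h0
  · rw [h1, one_nsmul] at hn
    exact absurd hn hT
  · rw [h2, two_nsmul, 𝒯.T_add_T, neg_eq_zero] at hn
    exact absurd hn hT

/-- The values of `chiT` are `O, T, −T`. [cite: SilvermanAEC2009, Thm. X.4.2 (a)] -/
theorem chiT_mem (n : ZMod 3) : 𝒯.chiT n = 0 ∨ 𝒯.chiT n = 𝒯.T ∨ 𝒯.chiT n = -𝒯.T := by
  rw [chiT_eq_val_nsmul]
  have hlt := n.val_lt
  have h3 : n.val = 0 ∨ n.val = 1 ∨ n.val = 2 := by omega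
  rcases h3 with h | h | h <;> rw [h]
  · exact Or.inl (zero_nsmul _)
  · exact Or.inr (Or.inl (one_nsmul _))
  · exact Or.inr (Or.inr (by rw [two_nsmul, 𝒯.T_add_T]))

/-- Conversely every point of `{O, T, −T}` is `nT` for some `n ∈ ℤ/3ℤ`. [cite: SilvermanAEC2009, Thm. X.4.2 (a)] -/
theorem exists_chiT_eq {P : geomPoints W} (hP : P = 0 ∨ P = 𝒯.T ∨ P = -𝒯.T) :
    ∃ n : ZMod 3, 𝒯.chiT n = P := by
  rcases hP with h | h | h
  · exact ⟨0, by rw [map_zero, h]⟩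
  · exact ⟨1, by rw [chiT_one, h]⟩
  · exact ⟨-1, by rw [map_neg, chiT_one, h]⟩

/-- **Galois equivariance of `n ↦ nT`**: `σ (n T) = (ε(σ) · n) T` — `⟨T⟩ ≅ μ₃`. [cite: SilvermanAEC2009, Thm. X.4.2 (a)] -/
theorem smul_chiT (σ : Field.absoluteGaloisGroup K) (k : ZMod 3) :
    σ • 𝒯.chiT k = 𝒯.chiT (eps σ * k) := by
  have hz : ∀ z : ℤ, σ • (z • 𝒯.T) = z • (σ • 𝒯.T) := fun z =>
    map_zsmul (DistribSMul.toAddMonoidHom (geomPoints W) σ) z 𝒯.T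
  rw [← ZMod.intCast_zmod_cast k, chiT_intCast, hz, 𝒯.smul_T, eps]
  split_ifs
  · rw [one_mul, chiT_intCast]
  · rw [neg_one_mul, ← Int.cast_neg, chiT_intCast, neg_zsmul, zsmul_neg]

/-- A cocycle of the shape `σ ↦ ((ε σ − 1) j) T` is the coboundary of `j T`. [cite: SilvermanAEC2009, Thm. X.4.2 (a)] -/
theorem chiT_eps_sub_one_mul (σ : Field.absoluteGaloisGroup K) (j : ZMod 3) :
    𝒯.chiT ((eps σ - 1) * j) = σ • 𝒯.chiT j - 𝒯.chiT j := by
  rw [sub_mul, one_mul, map_sub, smul_chiT]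

/-! ## The torsor cocycles `σ ↦ kummerExp a σ · T` and their classes in `H¹(K, W)` -/

variable [CharZero K]

/-- The values `σ ↦ (kummerExp a σ) T` of the cocycle attached to `a ∈ K*`. [cite: SilvermanAEC2009, Thm. X.4.2 (a)] -/
def torsorFun (a : K) (σ : Field.absoluteGaloisGroup K) : geomPoints W :=
  𝒯.chiT (kummerExp a σ)

/-- **The crossed-homomorphism identity** `f(στ) = f(σ) + σ f(τ)`: the Kummer cocycle identity
`n(στ) = n(σ) + ε(σ) n(τ)` together with `σ T = ε(σ) T`. [cite: SilvermanAEC2009, Thm. X.4.2 (a)] -/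
theorem torsorFun_mul {a : K} (ha : a ≠ 0) (σ τ : Field.absoluteGaloisGroup K) :
    𝒯.torsorFun a (σ * τ) = 𝒯.torsorFun a σ + σ • 𝒯.torsorFun a τ := by
  simp only [torsorFun]
  rw [kummerExp_mul ha, map_add, smul_chiT]

/-- The cocycle is locally constant, hence continuous. [cite: SilvermanAEC2009, Thm. X.4.2 (a)] -/
theorem continuous_torsorFun {a : K} (ha : a ≠ 0) : Continuous (𝒯.torsorFun a) := by
  apply IsLocallyConstant.continuous
  rw [IsLocallyConstant.iff_exists_open]
  intro σ
  refine ⟨{σ' | galAut σ' (cubeRoot a) = galAut σ (cubeRoot a)}, isOpen_setOf_galAut_eq _ _, rfl,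
    fun σ' hσ' => ?_⟩
  simp only [torsorFun]
  rw [kummerExp_eq_of_galAut_eq ha (hσ'.trans (galAut_cubeRoot ha σ)), ZMod.natCast_zmod_val]

/-- **The torsor cocycle** of `a ∈ K*`: the continuous crossed homomorphism
`σ ↦ (kummerExp a σ) T : Γ_K → W(K̄)`, image of the Kummer cocycle of `∛a` under
`μ₃ ≅ ⟨T⟩ ⊂ W(K̄)`. [cite: SilvermanAEC2009, Thm. X.4.2 (a)] -/
def torsorCocycle {a : K} (ha : a ≠ 0) :
    GaloisRepresentations.contOneCocycles
      (discreteTopRep (Field.absoluteGaloisGroup K) (geomPoints W)) :=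
  ⟨⟨𝒯.torsorFun a, 𝒯.continuous_torsorFun ha⟩, fun σ τ => by
    change 𝒯.torsorFun a (σ * τ) = 𝒯.torsorFun a σ + σ • 𝒯.torsorFun a τ
    exact 𝒯.torsorFun_mul ha σ τ⟩

/-- Values of the torsor cocycle. [cite: SilvermanAEC2009, Thm. X.4.2 (a)] -/
@[simp]
theorem torsorCocycle_apply {a : K} (ha : a ≠ 0) (σ : Field.absoluteGaloisGroup K) :
    (𝒯.torsorCocycle ha).1 σ = 𝒯.torsorFun a σ :=
  rfl

/-- **The class `[C_a] ∈ H¹(K, W)` of the torsor attached to `a ∈ K*`**: the image of `a` under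
`K*/K*³ = H¹(K, μ₃) = H¹(K, ⟨T⟩) → H¹(K, W)`. [cite: SilvermanAEC2009, Thm. X.4.2 (a)] -/
def torsorClass {a : K} (ha : a ≠ 0) : W.galH1 :=
  GaloisRepresentations.oneCocycleClass _ (𝒯.torsorCocycle ha)

/-- The class only depends on `a`. [cite: SilvermanAEC2009, Thm. X.4.2 (a)] -/
theorem torsorClass_congr {a b : K} (ha : a ≠ 0) (hb : b ≠ 0) (h : a = b) :
    𝒯.torsorClass ha = 𝒯.torsorClass hb := by
  subst h; rfl

/-- For the Mordell datum the class is the tree's `MordellDescent.torsorClass`. [cite: SilvermanAEC2009, Thm. X.4.2 (a)] -/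
theorem torsorClass_ofMordell {D c : K} (hc : c ≠ 0) (hD : D = -3 * c ^ 2) {a : K} (ha : a ≠ 0) :
    (ofMordell hc hD).torsorClass ha = MordellDescent.torsorClass hc hD ha := rfl

/-- **`3 · [C_a] = 0`**: the cocycle takes values in `⟨T⟩ ⊆ W[3]`. [cite: SilvermanAEC2009, Thm. X.4.2 (a)] -/
theorem three_nsmul_torsorClass {a : K} (ha : a ≠ 0) : 3 • 𝒯.torsorClass ha = 0 := by
  refine nsmul_oneCocycleClass_eq_zero _ 3 fun σ => ?_
  rw [torsorCocycle_apply, torsorFun, ← map_nsmul, nsmul_eq_mul, Nat.cast_ofNat,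
    show (3 : ZMod 3) = 0 from rfl, zero_mul, map_zero]

/-- **The class vanishes on cubes**: if `a = b³` then `[C_a] = 0` (`∛a = ω^j b`, and the cocycle is
the coboundary of `jT`). [cite: SilvermanAEC2009, Thm. X.4.2 (a)] -/
theorem torsorClass_of_eq_cube {a : K} (ha : a ≠ 0) (b : K) (h : a = b ^ 3) :
    𝒯.torsorClass ha = 0 := by
  obtain ⟨j, -, hj⟩ := exists_cubeRoot_eq_of_eq_cube ha h
  unfold torsorClass
  rw [GaloisRepresentations.oneCocycleClass_eq_zero_iff]
  refine ⟨𝒯.chiT j, fun σ => ?_⟩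
  change 𝒯.torsorFun a σ = σ • 𝒯.chiT j - 𝒯.chiT j
  rw [torsorFun, kummerExp_of_eq_cube ha hj, chiT_eps_sub_one_mul]

/-- **Multiplicativity**: `[C_{ab}] = [C_a] + [C_b]` in `H¹(K, W)` — the cocycles differ by the
coboundary of `jT`, `∛(ab) = ω^j ∛a ∛b`. [cite: SilvermanAEC2009, Thm. X.4.2 (a)] -/
theorem torsorClass_mul {a b : K} (ha : a ≠ 0) (hb : b ≠ 0) :
    𝒯.torsorClass (mul_ne_zero ha hb) = 𝒯.torsorClass ha + 𝒯.torsorClass hb := by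
  obtain ⟨j, -, hj⟩ := exists_cubeRoot_mul ha hb
  unfold torsorClass
  rw [← sub_eq_zero, ← GaloisRepresentations.oneCocycleClass_add,
    ← GaloisRepresentations.oneCocycleClass_sub, GaloisRepresentations.oneCocycleClass_eq_zero_iff]
  refine ⟨𝒯.chiT j, fun σ => ?_⟩
  change 𝒯.torsorFun (a * b) σ - (𝒯.torsorFun a σ + 𝒯.torsorFun b σ) = σ • 𝒯.chiT j - 𝒯.chiT j
  simp only [torsorFun]
  rw [kummerExp_mul_left ha hb hj, map_add, map_add, chiT_eps_sub_one_mul]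
  abel

/-- `[C_{a w³}] = [C_a]`. [cite: SilvermanAEC2009, Thm. X.4.2 (a)] -/
theorem torsorClass_mul_pow_three {a w : K} (ha : a ≠ 0) (hw : w ≠ 0) :
    𝒯.torsorClass (mul_ne_zero ha (pow_ne_zero 3 hw)) = 𝒯.torsorClass ha := by
  rw [𝒯.torsorClass_mul ha (pow_ne_zero 3 hw), 𝒯.torsorClass_of_eq_cube (pow_ne_zero 3 hw) w rfl,
    add_zero]

/-- `[C_a]` for `a ∈ Kˣ`, as a monoid homomorphism `Kˣ → H¹(K, W)` (written multiplicatively).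
[cite: SilvermanAEC2009, Thm. X.4.2 (a)] -/
def torsorClassHom : Kˣ →* Multiplicative W.galH1 where
  toFun u := Multiplicative.ofAdd (𝒯.torsorClass u.ne_zero)
  map_one' := by
    rw [𝒯.torsorClass_of_eq_cube (1 : Kˣ).ne_zero 1 (by simp)]
    rfl
  map_mul' u v := by
    rw [← ofAdd_add, ← torsorClass_mul]

/-- Values of `torsorClassHom`. [cite: SilvermanAEC2009, Thm. X.4.2 (a)] -/
theorem torsorClassHom_apply (u : Kˣ) :
    𝒯.torsorClassHom u = Multiplicative.ofAdd (𝒯.torsorClass u.ne_zero) :=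
  rfl

/-- **The map kills cubes**: `Kˣ³ ≤ ker`, so `[C_·]` factors through `Kˣ/Kˣ³ = H¹(K, μ₃)`.
[cite: SilvermanAEC2009, Thm. X.4.2 (a)] -/
theorem range_powMonoidHom_three_le_ker :
    (powMonoidHom 3 : Kˣ →* Kˣ).range ≤ 𝒯.torsorClassHom.ker := by
  rintro _ ⟨u, rfl⟩
  rw [MonoidHom.mem_ker, torsorClassHom_apply,
    𝒯.torsorClass_of_eq_cube _ (u : K) (by rw [powMonoidHom_apply]; push_cast; ring)]
  rfl

/-- **`Kˣ/Kˣ³ → H¹(K, W)[3]`**, `[a] ↦ [C_a]`: the map `H¹(K, ⟨T⟩) → H¹(K, W)` of the descent.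
[cite: SilvermanAEC2009, Thm. X.4.2 (a)] -/
def torsorClassQuotHom : CubeUnits K →* Multiplicative W.galH1 :=
  QuotientGroup.lift _ 𝒯.torsorClassHom 𝒯.range_powMonoidHom_three_le_ker

/-- Values of `torsorClassQuotHom` on classes of units. [cite: SilvermanAEC2009, Thm. X.4.2 (a)] -/
theorem torsorClassQuotHom_mk (u : Kˣ) :
    𝒯.torsorClassQuotHom (QuotientGroup.mk u) = Multiplicative.ofAdd (𝒯.torsorClass u.ne_zero) :=
  rfl

/-- Values of `torsorClassQuotHom` on `cubeClass a`, `a ≠ 0`. [cite: SilvermanAEC2009, Thm. X.4.2 (a)] -/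
theorem torsorClassQuotHom_cubeClass {a : K} (ha : a ≠ 0) :
    𝒯.torsorClassQuotHom (cubeClass a) = Multiplicative.ofAdd (𝒯.torsorClass ha) := by
  rw [cubeClass_of_ne_zero ha, torsorClassQuotHom_mk]
  rfl

/-- `[C_a] = 0` and `[a] ∈ ker torsorClassQuotHom` say the same thing. [cite: SilvermanAEC2009, Thm. X.4.2 (a)] -/
theorem torsorClass_eq_zero_iff_cubeClass_mem_ker {a : K} (ha : a ≠ 0) :
    𝒯.torsorClass ha = 0 ↔ cubeClass a ∈ 𝒯.torsorClassQuotHom.ker := by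
  rw [MonoidHom.mem_ker, torsorClassQuotHom_cubeClass _ ha]
  exact ⟨fun h => by rw [h]; rfl, fun h => Multiplicative.ofAdd.injective h⟩

/-- Equal cube classes give equal torsor classes. [cite: SilvermanAEC2009, Thm. X.4.2 (a)] -/
theorem torsorClass_eq_of_cubeClass_eq {a b : K} (ha : a ≠ 0) (hb : b ≠ 0)
    (h : cubeClass a = cubeClass b) : 𝒯.torsorClass ha = 𝒯.torsorClass hb := by
  have := congrArg 𝒯.torsorClassQuotHom h
  rw [torsorClassQuotHom_cubeClass _ ha, torsorClassQuotHom_cubeClass _ hb] at this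
  exact Multiplicative.ofAdd.injective this

end MuThreeKernel

end Literature.NumberTheory.EllipticCurves

end
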